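import Summits.QuantumFields.BalabanUV.Beta.MultiscaleRegularityClosed
import Summits.QuantumFields.BalabanUV.Beta.MultiscaleGlobalMember

/-!
# `Summit.QuantumFields.BalabanUV.Beta.MultiscaleGlobalMemberClosed` — engine file 18: the GLOBAL MEMBER (3.47)₁'s SHAPE for
# `levelOp` — `|((levelOp)⁻¹u)(p)| ≤ B·n(x)²·n(x)^γ·U` whenever `|u| ≤ n^γ·U` — WITH NO BINDER LEFT: file 13's
# `real_global_levelOp_inverse_le_of_grading` (modulo the local-regularity datum `hreg`) with `hreg` DISCHARGED by file 17's
# `hreg_holds` (co-owner beta-d4-p2's kernel mean-value inequality through the owner's assembly); so the members (3.46)₁, (3.42)₄,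
# (3.42)₁ AND (3.47)₁ of [B9] Thm 3.1∕(3.47) hold for the MODEL operator in the kernel with level-free constants

HONEST FRAMING (page 1 of everything in this cell).  Discharging `FlowStep.BetaPertH` would make Bałaban's ultraviolet
stability UNCONDITIONAL — a constructive-QFT result; it is NOT the continuum limit and NOT the Clay problem.  This module
discharges nothing of `BetaPertH`; it is [folklore] finite-dimensional bookkeeping about the MODEL operator, kernel-checked, by the
OWNER of binder row D4 (unit `b2b-balaban-beta-an4`, gen 45).  MODEL only: nothing of Bałaban's G′(U) is instantiated; the
gradient∕Hölder members (O.2 item (i)) remain OPEN; the critical path (T3) = NODE A.4 is UNCHANGED; D4 DISCHARGE NO DATE.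
HONEST DEPENDENCY: continuum YM on T⁴ ⇐ BetaPertH ∧ nine spine estimates (0/9 proved); BetaPertH ⇐ (D1) ∧ (D4) ∧ CAP+tail;
G-an2-4 gates asym, D1 and NE2/3/4.

WHAT IS CERTIFIED (kernel, 0 sorry, 0 def): **`real_global_levelOp_inverse_le`** — file 13 BY NAME with `hreg := hreg_holds`
(`ρ₀ = 4d + 1`, `c₁ = C_MV/√(θ^d) + √|Cp|(θ+1)²a_maxΓ²√(Γ^d)/(2c₀²)`, `c₂ = √|Cp|(θ+1)²/(2c₀²)`, `C_MV = max(√(11^d), C_d√(21^d))`).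
LOCATORS (shape only; ABSOLUTE RULE): [Balaban1985BackgroundPropagators] (3.47) p. 398, Thm 3.1 (3.42) p. 397.  NOT BetaPertH, NOT
continuum, NOT Clay, NOT summit progress.
-/

open scoped BigOperators
open Finset

namespace Summit.QuantumFields.BalabanUV.Beta.MultiscaleGlobalMemberClosed

open Summit.QuantumFields.BalabanUV.Beta.BoxPoincare (Box)
open Summit.QuantumFields.BalabanUV.Beta.MultiscaleCoerciveTorus
open Summit.QuantumFields.BalabanUV.Beta.MultiscaleDistance
open Summit.QuantumFields.BalabanUV.Beta.MultiscaleDecayBudget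
open Summit.QuantumFields.BalabanUV.Beta.MultiscaleGlobalMember (real_global_levelOp_inverse_le_of_grading)
open Summit.QuantumFields.BalabanUV.Beta.MultiscaleRegularityClosed (hreg_holds)
open Summit.QuantumFields.BalabanUV.Beta.SubsolutionMeanValueBox (Cmv)
open Literature.MathematicalPhysics.QuantumFieldTheory.Balaban1983to89
open Literature.MathematicalPhysics.QuantumFieldTheory.Balaban1983to89.B9Thm37GluePU (bsrc btgt)
open Literature.MathematicalPhysics.QuantumFieldTheory.Balaban1983to89.B9Thm37GlueTorusCov (tblk)
open Literature.MathematicalPhysics.QuantumFieldTheory.Balaban1983to89.B9Thm37GlueTorusCovLevels (levelOp)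
open B5TorusCover (UT Ctr ctrU)

noncomputable section

variable {d : ℕ} {N : Fin d → ℕ} [∀ i, NeZero (N i)] [NeZero d] {Cp J K : Type} [Fintype Cp] [DecidableEq Cp] [Nonempty Cp]
  [Fintype J] [Fintype K] [DecidableEq K] (S : J → ℕ) (hS : ∀ l, 1 ≤ S l) (hdivS : ∀ l i, S l ∣ N i) (lvl : K → J)
  (zc : (k : K) → Ctr N (S (lvl k)))
  (hdisj : ∀ k k' v v', cellPt S hS hdivS lvl zc k v = cellPt S hS hdivS lvl zc k' v' → k = k')
  (hcover : ∀ x : UT N, ∃ k, ∃ v : Box d (S (lvl k)), cellPt S hS hdivS lvl zc k v = x)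
  (Rm : UT N × Fin d → Cp → Cp → ℝ) (hRm : ∀ b i j, ∑ k, Rm b k i * Rm b k j = if i = j then (1 : ℝ) else 0)
  (T : J → UT N → Cp → Cp → ℝ) (hT : ∀ l x i i', ∑ k, T l x k i * T l x k i' = if i = i' then (1 : ℝ) else 0)
  (a : J → ℝ) (ha : ∀ j, 0 ≤ a j) (ω : J → UT N → ℝ)
  (hsupp : ∀ l x, ω l (ctrU N (S l) (tblk (hS l) (hdivS l) x)) ≠ 0 → ∃ k v, lvl k = l ∧ cellPt S hS hdivS lvl zc k v = x)
  {amax : ℝ} (hamax : 0 ≤ amax)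
  (hscale : ∀ k, a (lvl k) * ω (lvl k) (ctrU N (S (lvl k)) (zc k)) ^ 2 * (S (lvl k) : ℝ) ^ d ≤ amax / (S (lvl k) : ℝ) ^ 2)
  (c : UT N × Fin d → ℝ) {c₀ : ℝ} (hcc : ∀ b, c b = c₀) (hc₀ : c₀ ≠ 0) {cmax : ℝ} (hc : ∀ b, |c b| ≤ cmax) {C : ℝ}
  (hcoer : ∀ f : UT N × Cp → ℝ,
    C * ∑ k, ((S (lvl k) : ℝ) ^ 2)⁻¹ * ∑ v : Box d (S (lvl k)), ∑ i, f (cellPt S hS hdivS lvl zc k v, i) ^ 2 ≤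
      ∑ p, f p * levelOp bsrc btgt c Rm (fun l x => ctrU N (S l) (tblk (hS l) (hdivS l) x))
        (fun l x => ω l (ctrU N (S l) (tblk (hS l) (hdivS l) x))) T a f p)
  {κ : ℝ} (hκ0 : 0 ≤ κ) (hκ1 : κ ≤ 1)
  {L : ℕ} (hL : 1 ≤ L) (e : J → ℕ) (hSe : ∀ l, S l = L ^ e l) {R : ℝ} (hR : 0 < R) {A : ℕ}
  (hadd : ∀ x y : UT N, |(e (lvl (cellOf S hS hdivS lvl zc hcover x)) : ℝ) - e (lvl (cellOf S hS hdivS lvl zc hcover y))| ≤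
    A + sdist bsrc btgt (siteScale S hS hdivS lvl zc hcover) x y / R)

include hdisj hT ha hsupp hamax hscale hL e hSe hR hadd hRm hcc hc₀ hc hcoer hκ0 hκ1

/-- **THE GLOBAL MEMBER (3.47)₁'s SHAPE FOR `levelOp` WITH NO BINDER LEFT.**  MODEL setting of `MultiscaleDecay.hc_levelOp` with a
CONSTANT bond weight, the additive grading, the (P) budget, the rate condition; `Γ = L^A·e^{(log L/R)(4d+1)}`, `θ = 1/(4dΓ)`; an
exponent `γ` with `δ_γ = κ − (1+d/2)log L/R − |γ|·log L/R ≥ 0` and a margin `ε > 0` with `e^{ε + 2(log L/R)d}·e^{−δ_γ} < 1`: for every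
`u` with `|u(q)| ≤ n(q)^γ·U` (`U ≥ 0`) and every `p`, `|((levelOp)⁻¹u)(p)| ≤ B·n(p)²·n(p)^γ·U` with file 13's `B` at `ρ₀ = 4d+1` and
file 17's `c₁, c₂` — constants seeing `d, c₀, c_max, a_max, C, κ, L, A, R, |Cp|, γ, ε` ONLY.  File 13 BY NAME with `hreg := hreg_holds`.
[cite: Balaban1985BackgroundPropagators, (3.47) p.398] [folklore] -/
theorem real_global_levelOp_inverse_le
    (hμ : 0 < C - 2 * d * cmax ^ 2 * κ ^ 2 - amax * (Real.exp (2 * d * κ) - 1))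
    (hrate : (1 + d / 2) * (Real.log L / R) ≤ κ)
    {Γ θ : ℝ} (hΓ : Γ = (L : ℝ) ^ A * Real.exp (Real.log L / R * (4 * d + 1))) (hθ : θ = 1 / (4 * d * Γ))
    {γ : ℝ} (hδ : 0 ≤ κ - (1 + d / 2) * (Real.log L / R) - |γ| * (Real.log L / R)) {ε : ℝ} (hε : 0 < ε)
    (hq : Real.exp (ε + 2 * (Real.log L / R) * d) *
      Real.exp (-(κ - (1 + d / 2) * (Real.log L / R) - |γ| * (Real.log L / R))) < 1)
    (u : UT N × Cp → ℝ) {U : ℝ} (hU : 0 ≤ U) (hu : ∀ q, |u q| ≤ (siteScale S hS hdivS lvl zc hcover q.1 : ℝ) ^ γ * U)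
    (p : UT N × Cp) :
    |(Ring.inverse (levelOp bsrc btgt c Rm (fun l x => ctrU N (S l) (tblk (hS l) (hdivS l) x))
        (fun l x => ω l (ctrU N (S l) (tblk (hS l) (hdivS l) x))) T a)) u p| ≤
      ((max (Real.sqrt (11 ^ d)) (Cmv d * Real.sqrt (21 ^ d)) / Real.sqrt (θ ^ d) +
            Real.sqrt (Fintype.card Cp) * (θ + 1) ^ 2 * (amax * Γ ^ 2 * Real.sqrt (Γ ^ d)) / (2 * c₀ ^ 2)) *
          (Real.sqrt (Fintype.card Cp) * Real.exp (κ * ((4 * d + 1) + 2 * d)) *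
            ((L : ℝ) ^ A * Real.exp (Real.log L / R * (4 * d + 1))) * (L : ℝ) ^ A * Real.sqrt (((L : ℝ) ^ A) ^ d) /
            (C - 2 * d * cmax ^ 2 * κ ^ 2 - amax * (Real.exp (2 * d * κ) - 1))) +
          Real.sqrt (Fintype.card Cp) * (θ + 1) ^ 2 / (2 * c₀ ^ 2) *
            Real.exp ((κ - (1 + d / 2) * (Real.log L / R)) * ((4 * d + 1) + 2 * d))) *
        ((L : ℝ) ^ A) ^ |γ| * Real.exp (2 * d * (κ - (1 + d / 2) * (Real.log L / R) - |γ| * (Real.log L / R))) *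
        ((3 * ((L : ℝ) ^ A) ^ 2) ^ d * ((d.factorial : ℝ) / ε ^ d) * Real.exp (2 * d * (ε + Real.log L / R * d)) *
            Real.exp (ε + 2 * (Real.log L / R) * d) /
          (1 - Real.exp (ε + 2 * (Real.log L / R) * d) *
            Real.exp (-(κ - (1 + d / 2) * (Real.log L / R) - |γ| * (Real.log L / R))))) *
        (siteScale S hS hdivS lvl zc hcover p.1 : ℝ) ^ 2 * (siteScale S hS hdivS lvl zc hcover p.1 : ℝ) ^ γ * U := by
  have hd0 : (0 : ℝ) < d := by exact_mod_cast Nat.pos_of_ne_zero (NeZero.ne d)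
  have hL0 : (0 : ℝ) < L := by exact_mod_cast hL
  have hΓ0 : 0 < Γ := by rw [hΓ]; positivity
  have hθ0 : 0 < θ := by rw [hθ]; positivity
  have hc₁ : 0 ≤ max (Real.sqrt (11 ^ d)) (Cmv d * Real.sqrt (21 ^ d)) / Real.sqrt (θ ^ d) +
      Real.sqrt (Fintype.card Cp) * (θ + 1) ^ 2 * (amax * Γ ^ 2 * Real.sqrt (Γ ^ d)) / (2 * c₀ ^ 2) :=
    add_nonneg (div_nonneg (le_max_of_le_left (Real.sqrt_nonneg _)) (Real.sqrt_nonneg _)) (by positivity)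
  have hc₂ : 0 ≤ Real.sqrt (Fintype.card Cp) * (θ + 1) ^ 2 / (2 * c₀ ^ 2) := by positivity
  exact real_global_levelOp_inverse_le_of_grading S hS hdivS lvl zc hdisj hcover Rm hRm T hT a ha ω hsupp hamax hscale c hc hcoer
    hκ0 hκ1 hμ hL e hSe hR hadd hrate hc₁ hc₂
    (hreg_holds S hS hdivS lvl zc hdisj hcover Rm hRm T hT a ha ω hsupp hamax hscale c hcc hc₀ hL e hSe hR hadd hΓ hθ)
    hδ hε hq u hU hu p

end

end Summit.QuantumFields.BalabanUV.Beta.MultiscaleGlobalMemberClosed
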